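import Summits.QuantumAdvantage.QuantumAdvantage.Theorems.CubicForrelationNearExactIsExactCubicFormFrame

/-!
# Crux `CubicForrelation.NearExactIsExact` (stmt-QuantumAdvantage-14043) — a frame ADAPTED TO ONE PARITY FORM (coordinates for a hyperplane)

Certificate seat `b2b-cforr-cert` (gen 40).  HONEST FRAMING: kernel-checked linear algebra over `𝔽₂` (standard axioms), companion of
…CubicFormFrame (`tcr_adapted_frame`: a direction and two forms).  In the light-cell analysis of `E1280-even`
(HOME/b2b-cforr-cert-g40/LEAN-PLAN-E1280-EVEN.md §4) a light cell lives in an affine hyperplane `{⟨s,z⟩ = b}` of `𝔽₂⁹`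
(`kt3_structure`); to read it as a function of `8` coordinates one needs an invertible `P` with `⟨P y, z⟩ = y₀`, which this file provides.
Nothing about `θ₁₂`; NOT summit progress.

* `tcr1_adapted_frame`: for a non-zero parity form `z` on `1 + m` bits there are `P, Pi` over `𝔽₂` with `P Pi = Pi P = 1` and
  `⟨P y, z⟩ = y₀` for every bit vector `y` (coordinate `0 = Fin.castAdd m 0`).

References: folklore linear algebra.  Axioms: the standard three.
-/

set_option linter.dupNamespace false -- D-0017: single-problem summit ⇒ `QuantumAdvantage.QuantumAdvantage` by design

namespace Summit.QuantumAdvantage.QuantumAdvantage.Theorems.CubicForrelation.NearExactIsExact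

open Finset Module
open Literature.Computability.QuantumComplexity.BuzetChailloux (zeroVec)

/-- **A frame adapted to one parity form.**  For `z ≠ 0` on `1 + m` bits there are matrices `P, Pi` over `𝔽₂` with `P Pi = Pi P = 1` such
that `⟨P y, z⟩ = y₀` for every bit vector `y`: in the new coordinates the hyperplanes `{⟨x,z⟩ = b}` are `{y₀ = b}`. [folklore] -/
theorem tcr1_adapted_frame {m : ℕ} (z : Fin (1 + m) → Bool) (hz : z ≠ zeroVec) :
    ∃ P Pi : Fin (1 + m) → Fin (1 + m) → ZMod 2,
      (∀ ψ ω, (∑ φ, P ψ φ * Pi φ ω) = if ψ = ω then 1 else 0) ∧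
      (∀ ψ ω, (∑ φ, Pi ψ φ * P φ ω) = if ψ = ω then 1 else 0) ∧
      (∀ y : Fin (1 + m) → Bool,
        decide (Odd #(univ.filter fun j =>
          (fun ψ => decide ((∑ φ, P ψ φ * (if y φ = true then (1 : ZMod 2) else 0)) = 1)) j && z j)) = y (Fin.castAdd m (0 : Fin 1))) := by
  classical
  set ζ : Fin (1 + m) → ZMod 2 := fun j => if z j = true then 1 else 0 with hζ
  set f : (Fin (1 + m) → ZMod 2) → ZMod 2 := fun v => ∑ j, v j * ζ j with hf
  have hlin : ∀ {ι : Type} [Fintype ι] (g : ι → ZMod 2) (b : ι → Fin (1 + m) → ZMod 2),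
      (∑ j, (∑ i, g i • b i) j * ζ j) = ∑ i, g i * ∑ j, b i j * ζ j := by
    intro ι _ g b
    simp only [Finset.sum_apply, Pi.smul_apply, smul_eq_mul, sum_mul, mul_sum]
    rw [sum_comm]
    exact sum_congr rfl fun i _ => sum_congr rfl fun j _ => by ring
  -- a vector `u` with `f u = 1`: a unit vector at a coordinate where `z` is `1`
  obtain ⟨i₀, hi₀⟩ : ∃ i, z i = true := by
    by_contra hno
    push Not at hno
    exact hz (funext fun i => by simpa [zeroVec] using hno i)
  set u : Fin (1 + m) → ZMod 2 := fun j => if j = i₀ then 1 else 0 with hu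
  have hfu : f u = 1 := by
    show (∑ j, (if j = i₀ then (1 : ZMod 2) else 0) * ζ j) = 1
    simp only [ite_mul, one_mul, zero_mul, sum_ite_eq', mem_univ, if_true, hζ, hi₀, if_true]
  have hli1 : LinearIndependent (ZMod 2) ![u] := by
    rw [Fintype.linearIndependent_iff]
    intro g hg i
    have e := congrArg f hg
    simp only [hf, hlin, Pi.zero_apply, zero_mul, sum_const_zero] at e
    rw [Fin.sum_univ_one] at e
    simp only [Matrix.cons_val_fin_one] at e
    have hfu' : (∑ j, u j * ζ j) = 1 := hfu
    rw [hfu', mul_one] at e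
    fin_cases i
    exact e
  obtain ⟨w, hw, hwv⟩ := tcr_extend ![u] hli1 m le_rfl
  have hw0 : w (Fin.castAdd m 0) = u := hwv 0
  set b : Fin (1 + m) → Fin (1 + m) → ZMod 2 :=
    Fin.append ![u] (fun σ => w (Fin.natAdd 1 σ) + f (w (Fin.natAdd 1 σ)) • u) with hb
  have hb0 : b (Fin.castAdd m 0) = u := by rw [hb, Fin.append_left]; rfl
  have hbσ : ∀ σ, b (Fin.natAdd 1 σ) = w (Fin.natAdd 1 σ) + f (w (Fin.natAdd 1 σ)) • u := by
    intro σ; rw [hb, Fin.append_right]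
  have hfb : ∀ φ, f (b φ) = if φ = Fin.castAdd m 0 then 1 else 0 := by
    intro φ
    refine Fin.addCases (fun t => ?_) (fun σ => ?_) φ
    · fin_cases t
      show f (b (Fin.castAdd m 0)) = if Fin.castAdd m (0 : Fin 1) = Fin.castAdd m 0 then 1 else 0
      rw [hb0, if_pos rfl]; exact hfu
    · rw [hbσ, if_neg]
      · show (∑ j, (w (Fin.natAdd 1 σ) + f (w (Fin.natAdd 1 σ)) • u) j * ζ j) = 0
        simp only [Pi.add_apply, Pi.smul_apply, smul_eq_mul, add_mul, sum_add_distrib, mul_assoc, ← mul_sum]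
        have e1 : (∑ j, u j * ζ j) = 1 := hfu
        rw [e1, mul_one]
        change f (w (Fin.natAdd 1 σ)) + f (w (Fin.natAdd 1 σ)) = 0
        exact CharTwo.add_self_eq_zero _
      · intro h
        have := congrArg Fin.val h
        simp only [Fin.val_natAdd, Fin.val_castAdd] at this
        omega
  have hbli : LinearIndependent (ZMod 2) b := by
    rw [Fintype.linearIndependent_iff]
    intro g hg
    set g' : Fin (1 + m) → ZMod 2 := Fin.append
      ![g (Fin.castAdd m 0) + ∑ σ, g (Fin.natAdd 1 σ) * f (w (Fin.natAdd 1 σ))] (fun σ => g (Fin.natAdd 1 σ)) with hg'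
    have hsum : (∑ φ, g φ • b φ) = ∑ φ, g' φ • w φ := by
      rw [Fin.sum_univ_add, Fin.sum_univ_add, Fin.sum_univ_one, Fin.sum_univ_one, hb0, hw0]
      simp only [hg', Fin.append_left, Fin.append_right, hbσ, Matrix.cons_val_fin_one, smul_add, add_smul, sum_add_distrib,
        Finset.sum_smul, smul_smul]
      abel
    rw [hsum] at hg
    have hzero := (Fintype.linearIndependent_iff.mp hw) g' hg
    have gσ : ∀ σ, g (Fin.natAdd 1 σ) = 0 := fun σ => by
      have := hzero (Fin.natAdd 1 σ); rwa [hg', Fin.append_right] at this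
    have g0 : g (Fin.castAdd m 0) = 0 := by
      have := hzero (Fin.castAdd m 0); rw [hg', Fin.append_left] at this
      simpa [gσ] using this
    intro φ
    refine Fin.addCases (fun t => ?_) (fun σ => gσ σ) φ
    fin_cases t
    exact g0
  set P : Matrix (Fin (1 + m)) (Fin (1 + m)) (ZMod 2) := Matrix.of fun ψ φ => b φ ψ with hP
  have hcol : P.col = b := by funext φ ψ; rfl
  have hPu : IsUnit P := Matrix.linearIndependent_cols_iff_isUnit.mp (by rw [hcol]; exact hbli)
  have hdet : IsUnit P.det := (Matrix.isUnit_iff_isUnit_det P).mp hPu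
  have hPPi : P * P⁻¹ = 1 := Matrix.mul_nonsing_inv P hdet
  have hPiP : P⁻¹ * P = 1 := Matrix.nonsing_inv_mul P hdet
  refine ⟨fun ψ φ => P ψ φ, fun ψ φ => P⁻¹ ψ φ, fun ψ ω => ?_, fun ψ ω => ?_, fun y => ?_⟩
  · have := congrFun (congrFun hPPi ψ) ω
    rw [Matrix.mul_apply, Matrix.one_apply] at this
    exact this
  · have := congrFun (congrFun hPiP ψ) ω
    rw [Matrix.mul_apply, Matrix.one_apply] at this
    exact this
  · rw [tcr_parity_eq_decide_sum]
    have hread : ∀ t : ZMod 2, (if decide (t = 1) = true then (1 : ZMod 2) else 0) = t := by decide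
    simp only [hread]
    have hval : (∑ j, (∑ φ, P j φ * (if y φ = true then (1 : ZMod 2) else 0)) * (if z j = true then (1 : ZMod 2) else 0)) =
        if y (Fin.castAdd m (0 : Fin 1)) = true then 1 else 0 := by
      have h1 : ∀ j, (∑ φ, P j φ * (if y φ = true then (1 : ZMod 2) else 0)) =
          (∑ φ, (fun φ => if y φ = true then (1 : ZMod 2) else 0) φ • b φ) j := by
        intro j
        simp only [Finset.sum_apply, Pi.smul_apply, smul_eq_mul, hP, Matrix.of_apply]
        exact sum_congr rfl fun φ _ => mul_comm _ _
      simp only [h1]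
      have h2 := hlin (fun φ => if y φ = true then (1 : ZMod 2) else 0) b
      simp only [hζ] at h2
      rw [h2]
      have h3 : ∀ φ, (∑ j, b φ j * (if z j = true then (1 : ZMod 2) else 0)) = if φ = Fin.castAdd m 0 then 1 else 0 := hfb
      rw [sum_congr rfl fun φ _ => by rw [h3 φ]]
      simp only [mul_ite, mul_one, mul_zero, sum_ite_eq', mem_univ, if_true]
    rw [hval]
    cases y (Fin.castAdd m (0 : Fin 1)) <;> decide

end Summit.QuantumAdvantage.QuantumAdvantage.Theorems.CubicForrelation.NearExactIsExact
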